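/-
Copyright (c) 2026 the pub-hodgecm-mathlib formalisation cell (harness21).  Prover seat hodgecm-mathlib-K2Liu-p02 (g9), Track B «K2-LIT» ∕ hLiu418
#184♮, Road I v3, unit U5 «THE CLOSE», FACE-D₀ row `h2₂`, brick (B1c′-1) «two presentations of the theta-side Weil representation agree on `N_Δ`»
(LEAD F0P6-plan (g15) BATCH #181 (5), 2026-09-05).  THEOREMS ONLY.
-/
import Summits.HodgeConjecture.HodgeConjecture.Theorems.K2LiuUnipDeltaLeviConjugation      -- ★ `toBlocks₁₂_blk_levi_conj` (+ ★ α2c `isSiegelDelta_levi_apply`, ★ `exists_leviHom`)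
import Literature.NumberTheory.Weil1964.AdelicMetaplecticTwistCharacter                    -- ★ `adelicMpCont.exists_eq_twist`, `adelicMpCont.twist_eq_of_eq_one`
import Literature.NumberTheory.Weil1964.AdelicSiegelParabolicLiftConj                       -- ★ `adelicSiegelLiftConj`, `proj_adelicSiegelLiftConj`, `omega_adelicSiegelLiftConj_apply`
import Summits.HodgeConjecture.HodgeConjecture.Theorems.K2LiuCornerLineChartTwo            -- ★ `eq_of_mem_unipDelta_of_toBlocks₁₂_eq` (coordinate injectivity on `N_Δ(𝔸)`)
import HarnessLib

/-!
# K2_Liu road (hLiu418 = stmt-HodgeConjecture-24832), FACE-D₀ row `h2₂`, brick (B1c′-1): METAPLECTIC RIGIDITY ON THE SIEGEL UNIPOTENT RADICAL —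
# any two homomorphisms `P_Δ(𝔸) → Mp_ψ(𝕎_𝔸)ᶜᵒⁿᵗ` over the same symplectic map AGREE on `N_Δ(𝔸)`

Cell `pub/hodgecm-mathlib` (D-0151), Track B, build stream 29; helper lane `--supports stmt-HodgeConjecture-24832 --as helper`, count-neutral.

WHY.  The one letter `hκ` of ★ `K2LiuFirstTermLineLiftRankRowModelConj.h2Row_thetaSide_of_finLineModel_conj` (p863332) asks that, in a
κ-model, the Siegel unipotents `N_Δ(𝔸)` of the doubled unitary group `H = U(𝕍 ⊕ −𝕍)` act through the FACE's splitting
`pairSplitting (chiSplittingLine …) (toDiagA ·, 1)` by Weil's chirp — SCALAR-EXACTLY.  The census (B1c′) (R90-C14-p04, memo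
`CENSUS-B1c-core`) phrased the missing step as a comparison of «two presentations of the theta-side Weil representation» on `N_Δ(𝔸)`.
This file shows that NO presentation-specific input is needed: the comparison is group theory.

* §1 (generic; any number field `F`, index `ι`, Gram `T` a unit, any group `G`) **`apply_commutator_eq_of_proj_eq`** — two homomorphisms
  `s₁ s₂ : G →* Mp_ψ(𝕎_𝔸)ᶜᵒⁿᵗ` with `π ∘ s₁ = π ∘ s₂` differ by a character `G →* ℂˣ` (★ `adelicMpCont.exists_eq_twist`), which kills
  commutators (ℂˣ is abelian): `s₁ (a b a⁻¹ b⁻¹) = s₂ (a b a⁻¹ b⁻¹)`.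
* §2 (the doubled datum) **`eq_commutators_of_mem_unipDelta`** — every `u ∈ N_Δ(𝔸)` is a word in commutators of `P_Δ(𝔸)`:
  with the Levi homomorphism `Λ` (★ `exists_leviHom`, by value) and the scalars `2, 3 ∈ GL_n(𝔸_L)`,
  `Λ(c) u Λ(c)⁻¹ u⁻¹ = u^{c²−1}` (frame coordinate `X ↦ c X T⁻¹ c T = c² X`, ★ `toBlocks₁₂_blk_levi_conj`), so
  `u = u⁹ · u⁻⁸ = (Λ2 u Λ2⁻¹ u⁻¹)³ · (Λ3 u Λ3⁻¹ u⁻¹)⁻¹` — no division, no chart (coordinate injectivity ★ `eq_of_mem_unipDelta_of_toBlocks₁₂_eq`).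
* §3 **`eq_on_unipDelta_of_proj_eq`** — HEAD: any two homomorphisms `↥P_Δ(𝔸) →* Mp_ψ(𝕎_𝔸)ᶜᵒⁿᵗ` (ANY metaplectic target) over the same
  symplectic map coincide on `N_Δ(𝔸)`; `omega_eq_on_unipDelta_of_proj_eq` (operator form).
* §4 **`eq_adelicSiegelLiftConj_of_mem_unipDelta`** — the consumable instance: a homomorphism `s : H(𝔸) →* Mp_ψ(𝕎_𝔸)ᶜᵒⁿᵗ` whose symplectic
  image of `P_Δ(𝔸)` lies in a conjugate `g P_𝕐(𝔸) g⁻¹` of the standard Siegel parabolic EQUALS, on `N_Δ(𝔸)`, Weil's transported canonical lift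
  ★ `adelicSiegelLiftConj` `x ↦ q · 𝐫₀(g⁻¹ π(s x) g) · q⁻¹` — whence `ω(s u) Φ = M_q (ω(𝐫₀(g⁻¹ π(s u) g)) (M_q⁻¹ Φ))`
  (`omega_eq_conj_siegelLift_of_mem_unipDelta`): the `Tg := M_q⁻¹`-model of `hκ`, with NO `χ(det)`-normalisation, no continuity, no
  Θ-compatibility used.  This strengthens ★ (K-f) `K2LiuDoubledParabolicCayleyModel.omega_cayley_conj_sD` on `N_Δ(𝔸)` to arbitrary `sD` over `ι^𝔻`.

No definition, no instance, no notation, no named-fact hypothesis, no `sorry`; axioms ⊆ {propext, Classical.choice, Quot.sound}.  HONEST LABEL: HC_CM is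
proved only modulo the 7 printed citations (2 remaining named inputs: hLiu418 = stmt-HodgeConjecture-24832, h413 = stmt-HodgeConjecture-24833) until
rung 0 closes; this file moves no counter (`h2₂` needs in addition the LINE Cayley mover (B1c′-1)♭, the chirp reading (B1c′-2) and the S-letters).

References: [Weil1964] A. Weil, Acta Math. 111 (1964), Chap. I n° 13 p. 160 (`𝐫₀` on `P₀`), Chap. III n° 37 p. 188 (`1 → T → Mp → Sp`);
[MoeglinVignerasWaldspurger1987] LNM 1291, Chap. 2 II.1 (B), II.2; [GelbartRogawski1991] §3.1 Remark p. 457 L9–13 (`s* = s ⊗ ν′`);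
[Kudla1994] S. S. Kudla, Israel J. Math. 87 (1994), §3; [HarrisKudlaSweet1996] §1 (1.11)–(1.12).
-/

set_option autoImplicit false
set_option linter.dupNamespace false

noncomputable section

open scoped Matrix
open NumberField IsDedekindDomain

namespace Summit.HodgeConjecture.HodgeConjecture.Cruxes.HLiu418.K2LiuMetaplecticUnipotentRigidity

open Literature.NumberTheory.Automorphic Literature.NumberTheory.Automorphic.UnitaryGroup Literature.NumberTheory.GaloisRepresentations
open Literature.RepresentationTheory.HeisenbergGroup
open Literature.NumberTheory.GelbartRogawski1991 Literature.NumberTheory.GelbartRogawski1991.GRConstruction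
open Literature.NumberTheory.GelbartRogawski1991.AdaptedBlocks (cayR cayRinv)
open Literature.NumberTheory.K2Lit.SiegelDoubled
open Literature.NumberTheory.Weil1964
open Summit.HodgeConjecture.HodgeConjecture.Cruxes.HLiu418.K2LiuSiegelUnipotentCharacters (toBlocks₁₂_blk_mul toBlocks₁₂_blk_inv)
open Summit.HodgeConjecture.HodgeConjecture.Cruxes.HLiu418.K2LiuSiegelRationalLeviDecomposition (isSiegelDelta_levi_apply conj_levi_mem_unipDelta)
open Summit.HodgeConjecture.HodgeConjecture.Cruxes.HLiu418.K2LiuSiegelDoubledLeviMatrix (exists_leviHom isUnit_det_gramRA)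
open Summit.HodgeConjecture.HodgeConjecture.Cruxes.HLiu418.K2LiuUnipDeltaLeviConjugation (toBlocks₁₂_blk_levi_conj)
open Summit.HodgeConjecture.HodgeConjecture.Cruxes.HLiu418.K2LiuCornerLineChartTwo (eq_of_mem_unipDelta_of_toBlocks₁₂_eq)

/-! ## §1 Generic: two homomorphisms into `Mp_ψ(𝕎_𝔸)ᶜᵒⁿᵗ` over the same symplectic map agree on commutators -/

section Generic

variable {F : Type} [Field F] [NumberField F] {ι : Type} [Fintype ι] [DecidableEq ι] {T : Matrix ι ι (AdeleRing (𝓞 F) F)}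
variable {G : Type*} [Group G]

/-- **Commutator rigidity.**  If `s₁ s₂ : G →* Mp_ψ(𝕎_𝔸)ᶜᵒⁿᵗ` have the same symplectic projection, then `s₁ (a b a⁻¹ b⁻¹) = s₂ (a b a⁻¹ b⁻¹)` for all
`a b` — they differ by a character `χ : G →* ℂˣ` (★ `adelicMpCont.exists_eq_twist`), and `χ(a b a⁻¹ b⁻¹) = 1`.
[cite: GelbartRogawski1991, §3.1 Remark p. 457 L9–13] [cite: MoeglinVignerasWaldspurger1987, Chap. 2 II.1 (B)] -/
theorem apply_commutator_eq_of_proj_eq (hT : IsUnit T) (s₁ s₂ : G →* adelicMpCont F ι T)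
    (hproj : ∀ h, adelicMpCont.proj F ι T (s₁ h) = adelicMpCont.proj F ι T (s₂ h)) (a b : G) :
    s₁ (a * b * a⁻¹ * b⁻¹) = s₂ (a * b * a⁻¹ * b⁻¹) := by
  -- (`obtain` on the `MonoidHom` equation triggers a heavy `isDefEq`; eliminate the `∃` in term style)
  refine (adelicMpCont.exists_eq_twist s₁ s₂ hT hproj).elim fun χ hχ => ?_
  have h1 : χ (a * b * a⁻¹ * b⁻¹) = 1 := by
    rw [map_mul, map_mul, map_mul, map_inv, map_inv, mul_right_comm (χ a), mul_inv_cancel, one_mul, mul_inv_cancel]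
  have h2 : adelicMpCont.twist F ι T s₁ χ (a * b * a⁻¹ * b⁻¹) = s₁ (a * b * a⁻¹ * b⁻¹) :=
    adelicMpCont.twist_eq_of_eq_one s₁ χ h1
  have h3 : s₂ (a * b * a⁻¹ * b⁻¹) = adelicMpCont.twist F ι T s₁ χ (a * b * a⁻¹ * b⁻¹) := DFunLike.congr_fun hχ _
  exact (h3.trans h2).symm

/-- operator form: `ω(s₁ (a b a⁻¹ b⁻¹)) = ω(s₂ (a b a⁻¹ b⁻¹))`. [cite: GelbartRogawski1991, §3.1 p. 454 L21–33] -/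
theorem omega_commutator_eq_of_proj_eq (hT : IsUnit T) (s₁ s₂ : G →* adelicMpCont F ι T)
    (hproj : ∀ h, adelicMpCont.proj F ι T (s₁ h) = adelicMpCont.proj F ι T (s₂ h)) (a b : G) :
    adelicMpCont.omega F ι T (s₁ (a * b * a⁻¹ * b⁻¹)) = adelicMpCont.omega F ι T (s₂ (a * b * a⁻¹ * b⁻¹)) :=
  congrArg (adelicMpCont.omega F ι T) (apply_commutator_eq_of_proj_eq hT s₁ s₂ hproj a b)

/-- two homomorphisms over the same symplectic map agree on the word `(c₁)³ · (c₂)⁻¹` in two commutators `cᵢ = aᵢ b aᵢ⁻¹ b⁻¹` (the shape of §2).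
[cite: MoeglinVignerasWaldspurger1987, Chap. 2 II.1 (B)] -/
theorem apply_commutatorWord_eq_of_proj_eq (hT : IsUnit T) (s₁ s₂ : G →* adelicMpCont F ι T)
    (hproj : ∀ h, adelicMpCont.proj F ι T (s₁ h) = adelicMpCont.proj F ι T (s₂ h)) (a₁ a₂ b : G) :
    s₁ ((a₁ * b * a₁⁻¹ * b⁻¹) * (a₁ * b * a₁⁻¹ * b⁻¹) * (a₁ * b * a₁⁻¹ * b⁻¹) * (a₂ * b * a₂⁻¹ * b⁻¹)⁻¹) =
      s₂ ((a₁ * b * a₁⁻¹ * b⁻¹) * (a₁ * b * a₁⁻¹ * b⁻¹) * (a₁ * b * a₁⁻¹ * b⁻¹) * (a₂ * b * a₂⁻¹ * b⁻¹)⁻¹) := by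
  simp only [map_mul, map_inv, apply_commutator_eq_of_proj_eq hT s₁ s₂ hproj]

end Generic

/-! ## §2 The doubled datum: `N_Δ(𝔸)` consists of words in commutators of `P_Δ(𝔸)` -/

section Datum

variable (L : Type) [Field L] [NumberField L] [IsCMField L]
variable {N M n : ℕ} (e : Fin N × Fin M ≃ Fin n)
  (dV : Fin N → L) (hdV : ∀ i, IsCMField.complexConj L (dV i) = dV i)
  (dW : Fin M → L) (hdW : ∀ i, IsCMField.complexConj L (dW i) = dW i)

section Levi

variable (Λ : GL (Fin n) (AdeleRing (𝓞 L) L) →* HA L e dV hdV dW hdW)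
  (hΛ : ∀ g : GL (Fin n) (AdeleRing (𝓞 L) L), blk L e dV hdV dW hdW (Λ g) =
    cayR (AdeleRing (𝓞 L) L) (Fin n) * Matrix.fromBlocks (g : Matrix (Fin n) (Fin n) (AdeleRing (𝓞 L) L)) 0 0
      (((gramR L e dV hdV dW hdW).map ((algebraMap L (AdeleRing (𝓞 L) L)).comp (algebraMap (Fp L) L)))⁻¹ *
        (((g⁻¹ : GL (Fin n) (AdeleRing (𝓞 L) L)) : Matrix (Fin n) (Fin n) (AdeleRing (𝓞 L) L)).map
          (conjAdele (Fp L) L (IsCMField.complexConj L)))ᵀ *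
        (gramR L e dV hdV dW hdW).map ((algebraMap L (AdeleRing (𝓞 L) L)).comp (algebraMap (Fp L) L))) *
      cayRinv (AdeleRing (𝓞 L) L) (Fin n))

include hΛ in
/-- **Conjugating `N_Δ(𝔸)` by a SCALAR Levi element**: for a unit scalar `c ∈ 𝔸_L` fixed by `σ` (e.g. `2`, `3`), the frame coordinate of
`Λ(c) u Λ(c)⁻¹` is `(c·c) • X_u` (★ `toBlocks₁₂_blk_levi_conj`: `c X T⁻¹ (cᵀ)^σ T = c² X`). [cite: MoeglinWaldspurger1995, II.1.7] [cite: HarrisKudlaSweet1996, §1 (1.11)–(1.12)] -/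
theorem toBlocks₁₂_blk_levi_scalar_conj (hdV0 : ∀ i, dV i ≠ 0) (hdW0 : ∀ i, dW i ≠ 0) (c : (AdeleRing (𝓞 L) L)ˣ)
    (hσ : conjAdele (Fp L) L (IsCMField.complexConj L) (c : AdeleRing (𝓞 L) L) = c) {u : HA L e dV hdV dW hdW} (hu : u ∈ unipDelta L e dV hdV dW hdW) :
    (blk L e dV hdV dW hdW (Λ (Units.map (Matrix.scalar (Fin n)).toMonoidHom c) * u * (Λ (Units.map (Matrix.scalar (Fin n)).toMonoidHom c))⁻¹)).toBlocks₁₂ =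
      ((c : AdeleRing (𝓞 L) L) * c) • (blk L e dV hdV dW hdW u).toBlocks₁₂ := by
  have hT := isUnit_det_gramRA L e dV hdV dW hdW hdV0 hdW0
  have hx : ((Units.map (Matrix.scalar (Fin n)).toMonoidHom c : GL (Fin n) (AdeleRing (𝓞 L) L)) : Matrix (Fin n) (Fin n) (AdeleRing (𝓞 L) L)) =
      (c : AdeleRing (𝓞 L) L) • (1 : Matrix (Fin n) (Fin n) (AdeleRing (𝓞 L) L)) := by
    rw [Units.coe_map, RingHom.toMonoidHom_eq_coe, MonoidHom.coe_coe, Matrix.scalar_apply, Matrix.smul_one_eq_diagonal]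
  have hmap : (((c : AdeleRing (𝓞 L) L) • (1 : Matrix (Fin n) (Fin n) (AdeleRing (𝓞 L) L))).map (conjAdele (Fp L) L (IsCMField.complexConj L)))ᵀ =
      (c : AdeleRing (𝓞 L) L) • (1 : Matrix (Fin n) (Fin n) (AdeleRing (𝓞 L) L)) := by
    rw [Matrix.smul_one_eq_diagonal, Matrix.diagonal_map (map_zero _), Matrix.diagonal_transpose, hσ]
  rw [toBlocks₁₂_blk_levi_conj L e dV hdV dW hdW Λ hΛ _ hu, hx, hmap]
  simp only [Matrix.smul_mul, Matrix.mul_smul, Matrix.one_mul, Matrix.mul_one, Matrix.nonsing_inv_mul _ hT, smul_smul]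

include hΛ in
/-- **`Λ(c) u Λ(c)⁻¹ u⁻¹ = u^{c²−1}` read on coordinates**: the commutator of the scalar Levi element `Λ(c)` with `u ∈ N_Δ(𝔸)` lies in `N_Δ(𝔸)` and
has frame coordinate `(c·c − 1) • X_u`. [cite: MoeglinWaldspurger1995, II.1.7] [cite: Kudla1994, §3] -/
theorem toBlocks₁₂_blk_levi_scalar_commutator (hdV0 : ∀ i, dV i ≠ 0) (hdW0 : ∀ i, dW i ≠ 0) (c : (AdeleRing (𝓞 L) L)ˣ)
    (hσ : conjAdele (Fp L) L (IsCMField.complexConj L) (c : AdeleRing (𝓞 L) L) = c) {u : HA L e dV hdV dW hdW} (hu : u ∈ unipDelta L e dV hdV dW hdW) :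
    Λ (Units.map (Matrix.scalar (Fin n)).toMonoidHom c) * u * (Λ (Units.map (Matrix.scalar (Fin n)).toMonoidHom c))⁻¹ * u⁻¹ ∈ unipDelta L e dV hdV dW hdW ∧
      (blk L e dV hdV dW hdW (Λ (Units.map (Matrix.scalar (Fin n)).toMonoidHom c) * u * (Λ (Units.map (Matrix.scalar (Fin n)).toMonoidHom c))⁻¹ * u⁻¹)).toBlocks₁₂ =
        ((c : AdeleRing (𝓞 L) L) * c - 1) • (blk L e dV hdV dW hdW u).toBlocks₁₂ := by
  have hconj : Λ (Units.map (Matrix.scalar (Fin n)).toMonoidHom c) * u * (Λ (Units.map (Matrix.scalar (Fin n)).toMonoidHom c))⁻¹ ∈ unipDelta L e dV hdV dW hdW :=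
    conj_levi_mem_unipDelta L e dV hdV dW hdW Λ hΛ _ hu
  refine ⟨mul_mem hconj (inv_mem hu), ?_⟩
  rw [toBlocks₁₂_blk_mul L e dV hdV dW hdW hconj (inv_mem hu), toBlocks₁₂_blk_inv L e dV hdV dW hdW hu,
    toBlocks₁₂_blk_levi_scalar_conj L e dV hdV dW hdW Λ hΛ hdV0 hdW0 c hσ hu, sub_smul, one_smul, sub_eq_add_neg]

end Levi

omit [IsCMField L] in
/-- the numerals `2`, `3` of `𝔸_L` are units (`𝔸_L` is an algebra over the characteristic-zero field `L`). [folklore] -/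
theorem isUnit_ofNat (k : ℕ) [k.AtLeastTwo] : IsUnit (OfNat.ofNat k : AdeleRing (𝓞 L) L) := by
  have h : IsUnit (algebraMap L (AdeleRing (𝓞 L) L) (OfNat.ofNat k)) :=
    (IsUnit.mk0 (OfNat.ofNat k : L) (NeZero.ne (OfNat.ofNat k))).map _
  rwa [map_ofNat] at h

/-- **`N_Δ(𝔸) ⊆ [P_Δ(𝔸), P_Δ(𝔸)]`, ELEMENTWISE AND EXPLICITLY**: for `u ∈ N_Δ(𝔸)` there are `m₂ m₃ ∈ P_Δ(𝔸)` (the scalar Levi elements `Λ(2)`, `Λ(3)`)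
with `u = (m₂ u m₂⁻¹ u⁻¹)³ · (m₃ u m₃⁻¹ u⁻¹)⁻¹` — coordinates `3·(3X) − 8X = X` (★ `exists_leviHom`, `toBlocks₁₂_blk_levi_scalar_commutator`, no division).
[cite: MoeglinWaldspurger1995, II.1.7] [cite: Kudla1994, §3] [cite: HarrisKudlaSweet1996, §1 (1.11)–(1.12)] -/
theorem eq_commutators_of_mem_unipDelta (hdV0 : ∀ i, dV i ≠ 0) (hdW0 : ∀ i, dW i ≠ 0) {u : HA L e dV hdV dW hdW}
    (hu : u ∈ unipDelta L e dV hdV dW hdW) :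
    ∃ m₂ m₃ : HA L e dV hdV dW hdW, IsSiegelDelta L e dV hdV dW hdW m₂ ∧ IsSiegelDelta L e dV hdV dW hdW m₃ ∧
      u = (m₂ * u * m₂⁻¹ * u⁻¹) * (m₂ * u * m₂⁻¹ * u⁻¹) * (m₂ * u * m₂⁻¹ * u⁻¹) * (m₃ * u * m₃⁻¹ * u⁻¹)⁻¹ := by
  obtain ⟨Λ, -, hΛ⟩ := exists_leviHom L e dV hdV dW hdW hdV0 hdW0
  have h2 := isUnit_ofNat L 2
  have h3 := isUnit_ofNat L 3
  have hσ2 : conjAdele (Fp L) L (IsCMField.complexConj L) (h2.unit : AdeleRing (𝓞 L) L) = h2.unit := by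
    rw [IsUnit.unit_spec, map_ofNat]
  have hσ3 : conjAdele (Fp L) L (IsCMField.complexConj L) (h3.unit : AdeleRing (𝓞 L) L) = h3.unit := by
    rw [IsUnit.unit_spec, map_ofNat]
  set m₂ : HA L e dV hdV dW hdW := Λ (Units.map (Matrix.scalar (Fin n)).toMonoidHom h2.unit) with hm₂
  set m₃ : HA L e dV hdV dW hdW := Λ (Units.map (Matrix.scalar (Fin n)).toMonoidHom h3.unit) with hm₃
  obtain ⟨hc₂, hX₂⟩ := toBlocks₁₂_blk_levi_scalar_commutator L e dV hdV dW hdW Λ hΛ hdV0 hdW0 h2.unit hσ2 hu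
  obtain ⟨hc₃, hX₃⟩ := toBlocks₁₂_blk_levi_scalar_commutator L e dV hdV dW hdW Λ hΛ hdV0 hdW0 h3.unit hσ3 hu
  rw [IsUnit.unit_spec] at hX₂ hX₃
  rw [← hm₂] at hc₂ hX₂
  rw [← hm₃] at hc₃ hX₃
  refine ⟨m₂, m₃, isSiegelDelta_levi_apply L e dV hdV dW hdW Λ hΛ _, isSiegelDelta_levi_apply L e dV hdV dW hdW Λ hΛ _,
    eq_of_mem_unipDelta_of_toBlocks₁₂_eq L e dV hdV dW hdW hu (mul_mem (mul_mem (mul_mem hc₂ hc₂) hc₂) (inv_mem hc₃)) ?_⟩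
  rw [toBlocks₁₂_blk_mul L e dV hdV dW hdW (mul_mem (mul_mem hc₂ hc₂) hc₂) (inv_mem hc₃),
    toBlocks₁₂_blk_mul L e dV hdV dW hdW (mul_mem hc₂ hc₂) hc₂, toBlocks₁₂_blk_mul L e dV hdV dW hdW hc₂ hc₂,
    toBlocks₁₂_blk_inv L e dV hdV dW hdW hc₃, hX₂, hX₃, ← add_smul, ← add_smul, ← sub_eq_add_neg, ← sub_smul]
  conv_lhs => rw [← one_smul (AdeleRing (𝓞 L) L) (blk L e dV hdV dW hdW u).toBlocks₁₂]
  congr 1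
  norm_num

/-! ## §3 HEAD: two homomorphisms `P_Δ(𝔸) → Mp_ψ(𝕎_𝔸)ᶜᵒⁿᵗ` over the same symplectic map coincide on `N_Δ(𝔸)` -/

variable {F : Type} [Field F] [NumberField F] {ι : Type} [Fintype ι] [DecidableEq ι] {T : Matrix ι ι (AdeleRing (𝓞 F) F)}

/-- **METAPLECTIC RIGIDITY ON `N_Δ(𝔸)`.**  Let `s₁ s₂ : ↥P_Δ(𝔸) →* Mp_ψ(𝕎_𝔸)ᶜᵒⁿᵗ` (ANY number field, index, Gram unit `T` on the metaplectic side)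
have the same symplectic projection.  Then `s₁ = s₂` on `N_Δ(𝔸)` (§1 on the commutator word of §2).  In particular the «two presentations of the
theta-side Weil representation» of the census (B1c′) agree on `N_Δ(𝔸)`, with no `χ(det)`-normalisation, continuity or Θ-compatibility used.
[cite: MoeglinVignerasWaldspurger1987, Chap. 2 II.1 (B)] [cite: Kudla1994, §3] [cite: GelbartRogawski1991, §3.1 Remark p. 457 L9–13] -/
theorem eq_on_unipDelta_of_proj_eq (hdV0 : ∀ i, dV i ≠ 0) (hdW0 : ∀ i, dW i ≠ 0) (hT : IsUnit T)
    (s₁ s₂ : ↥(siegelDelta L e dV hdV dW hdW) →* adelicMpCont F ι T)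
    (hproj : ∀ p, adelicMpCont.proj F ι T (s₁ p) = adelicMpCont.proj F ι T (s₂ p))
    {u : HA L e dV hdV dW hdW} (hu : u ∈ unipDelta L e dV hdV dW hdW) :
    s₁ ⟨u, unipDelta_le_siegelDelta L e dV hdV dW hdW hu⟩ = s₂ ⟨u, unipDelta_le_siegelDelta L e dV hdV dW hdW hu⟩ := by
  -- (`obtain` would try to substitute the equation `u = …`; eliminate the `∃` in term style)
  refine (eq_commutators_of_mem_unipDelta L e dV hdV dW hdW hdV0 hdW0 hu).elim fun m₂ H₂ => H₂.elim fun m₃ H₃ => ?_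
  have hm₂ := H₃.1
  have hm₃ := H₃.2.1
  have hw := H₃.2.2
  have key := apply_commutatorWord_eq_of_proj_eq hT s₁ s₂ hproj (⟨m₂, hm₂⟩ : ↥(siegelDelta L e dV hdV dW hdW)) ⟨m₃, hm₃⟩
    ⟨u, unipDelta_le_siegelDelta L e dV hdV dW hdW hu⟩
  have hUw : (⟨u, unipDelta_le_siegelDelta L e dV hdV dW hdW hu⟩ : ↥(siegelDelta L e dV hdV dW hdW)) =
      ((⟨m₂, hm₂⟩ : ↥(siegelDelta L e dV hdV dW hdW)) * ⟨u, unipDelta_le_siegelDelta L e dV hdV dW hdW hu⟩ * ⟨m₂, hm₂⟩⁻¹ *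
          ⟨u, unipDelta_le_siegelDelta L e dV hdV dW hdW hu⟩⁻¹) *
        ((⟨m₂, hm₂⟩ : ↥(siegelDelta L e dV hdV dW hdW)) * ⟨u, unipDelta_le_siegelDelta L e dV hdV dW hdW hu⟩ * ⟨m₂, hm₂⟩⁻¹ *
          ⟨u, unipDelta_le_siegelDelta L e dV hdV dW hdW hu⟩⁻¹) *
        ((⟨m₂, hm₂⟩ : ↥(siegelDelta L e dV hdV dW hdW)) * ⟨u, unipDelta_le_siegelDelta L e dV hdV dW hdW hu⟩ * ⟨m₂, hm₂⟩⁻¹ *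
          ⟨u, unipDelta_le_siegelDelta L e dV hdV dW hdW hu⟩⁻¹) *
        ((⟨m₃, hm₃⟩ : ↥(siegelDelta L e dV hdV dW hdW)) * ⟨u, unipDelta_le_siegelDelta L e dV hdV dW hdW hu⟩ * ⟨m₃, hm₃⟩⁻¹ *
          ⟨u, unipDelta_le_siegelDelta L e dV hdV dW hdW hu⟩⁻¹)⁻¹ :=
    Subtype.ext hw
  exact ((congrArg s₁ hUw).trans key).trans (congrArg s₂ hUw).symm

/-- operator form of `eq_on_unipDelta_of_proj_eq`: `ω(s₁ u) = ω(s₂ u)` on `N_Δ(𝔸)`. [cite: GelbartRogawski1991, §3.1 p. 454 L21–33] -/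
theorem omega_eq_on_unipDelta_of_proj_eq (hdV0 : ∀ i, dV i ≠ 0) (hdW0 : ∀ i, dW i ≠ 0) (hT : IsUnit T)
    (s₁ s₂ : ↥(siegelDelta L e dV hdV dW hdW) →* adelicMpCont F ι T)
    (hproj : ∀ p, adelicMpCont.proj F ι T (s₁ p) = adelicMpCont.proj F ι T (s₂ p))
    {u : HA L e dV hdV dW hdW} (hu : u ∈ unipDelta L e dV hdV dW hdW) :
    adelicMpCont.omega F ι T (s₁ ⟨u, unipDelta_le_siegelDelta L e dV hdV dW hdW hu⟩) =
      adelicMpCont.omega F ι T (s₂ ⟨u, unipDelta_le_siegelDelta L e dV hdV dW hdW hu⟩) :=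
  congrArg (adelicMpCont.omega F ι T) (eq_on_unipDelta_of_proj_eq L e dV hdV dW hdW hdV0 hdW0 hT s₁ s₂ hproj hu)

/-- the same for two homomorphisms defined on ALL of `H(𝔸)` whose projections agree on `P_Δ(𝔸)`. [cite: MoeglinVignerasWaldspurger1987, Chap. 2 II.1 (B)] -/
theorem eq_on_unipDelta_of_proj_eq_on_siegelDelta (hdV0 : ∀ i, dV i ≠ 0) (hdW0 : ∀ i, dW i ≠ 0) (hT : IsUnit T)
    (s₁ s₂ : HA L e dV hdV dW hdW →* adelicMpCont F ι T)
    (hproj : ∀ p : HA L e dV hdV dW hdW, IsSiegelDelta L e dV hdV dW hdW p → adelicMpCont.proj F ι T (s₁ p) = adelicMpCont.proj F ι T (s₂ p))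
    {u : HA L e dV hdV dW hdW} (hu : u ∈ unipDelta L e dV hdV dW hdW) : s₁ u = s₂ u :=
  eq_on_unipDelta_of_proj_eq L e dV hdV dW hdW hdV0 hdW0 hT (s₁.comp (siegelDelta L e dV hdV dW hdW).subtype)
    (s₂.comp (siegelDelta L e dV hdV dW hdW).subtype) (fun p => hproj p p.2) hu

/-! ## §4 The consumable instance: `s|_{N_Δ(𝔸)}` IS Weil's transported canonical lift `x ↦ q · 𝐫₀(g⁻¹ π(s x) g) · q⁻¹` -/

section SiegelLift

variable {m : ℕ} {TA : Matrix (Fin m) (Fin m) (AdeleRing (𝓞 F) F)}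

/-- **ANY homomorphism `s : H(𝔸) →* Mp_ψ(𝕎_𝔸)ᶜᵒⁿᵗ` whose symplectic image of `P_Δ(𝔸)` lies in a conjugate Siegel parabolic `g P_𝕐(𝔸) g⁻¹` EQUALS, on
`N_Δ(𝔸)`, Weil's transported canonical lift** ★ `adelicSiegelLiftConj g q … (π ∘ s|_{P_Δ(𝔸)})` (`x ↦ q · 𝐫₀(g⁻¹ π(s x) g) · q⁻¹`, `q` any lift of `g` in
the group of record).  At the FACE's `s = pairSplitting (chiSplittingLine …) ∘ (toDiagA ·, 1)` and `g⁻¹ =` the line Cayley mover this is brick (B1c′-1).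
[cite: Weil1964, Chap. I n° 13 p. 160; Chap. III n° 36–37 pp. 187–188] [cite: Kudla1994, §3] [cite: MoeglinVignerasWaldspurger1987, Chap. 2 II.1 (B)] -/
theorem eq_adelicSiegelLiftConj_of_mem_unipDelta (hdV0 : ∀ i, dV i ≠ 0) (hdW0 : ∀ i, dW i ≠ 0) (hT : IsUnit TA.det)
    (s : HA L e dV hdV dW hdW →* adelicMpCont F (Fin m) TA) (g : symplecticGroup (polar (adelicForm F (Fin m) TA)))
    (q : adelicMp F (Fin m) TA) (hqc : q ∈ adelicMpCont F (Fin m) TA) (hq : MpPsi.proj _ q = g)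
    (hj : ∀ p : ↥(siegelDelta L e dV hdV dW hdW),
      g⁻¹ * ((adelicMpCont.proj F (Fin m) TA).comp (s.comp (siegelDelta L e dV hdV dW hdW).subtype)) p * g ∈ siegelParabolicPi TA)
    {u : HA L e dV hdV dW hdW} (hu : u ∈ unipDelta L e dV hdV dW hdW) :
    s u = adelicSiegelLiftConj hT g q hqc hq ((adelicMpCont.proj F (Fin m) TA).comp (s.comp (siegelDelta L e dV hdV dW hdW).subtype)) hj
      ⟨u, unipDelta_le_siegelDelta L e dV hdV dW hdW hu⟩ :=
  eq_on_unipDelta_of_proj_eq L e dV hdV dW hdW hdV0 hdW0 ((Matrix.isUnit_iff_isUnit_det TA).2 hT)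
    (s.comp (siegelDelta L e dV hdV dW hdW).subtype) _
    (fun p => (proj_adelicSiegelLiftConj hT g q hqc hq _ hj p).symm) hu

/-- **THE κ-MODEL ON `N_Δ(𝔸)`, OPERATOR LEVEL**: `ω(s u) Φ = M_q (ω(𝐫₀(g⁻¹ π(s u) g)) (M_q⁻¹ Φ))` — with `Tg := M_q⁻¹` the Siegel unipotents act in the
`Tg`-model by Weil's canonical `𝐫₀` (the chirp of ★ `coe_toOp_adelicSiegelLift`), SCALAR-EXACTLY, for ANY such `s` (★ `omega_adelicSiegelLiftConj_apply`).
[cite: Weil1964, Chap. I n° 13 p. 160] [cite: Kudla1996, Chap. I §2 Prop. 2.3] [cite: Kudla1994, §3] -/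
theorem omega_eq_conj_siegelLift_of_mem_unipDelta (hdV0 : ∀ i, dV i ≠ 0) (hdW0 : ∀ i, dW i ≠ 0) (hT : IsUnit TA.det)
    (s : HA L e dV hdV dW hdW →* adelicMpCont F (Fin m) TA) (g : symplecticGroup (polar (adelicForm F (Fin m) TA)))
    (q : adelicMp F (Fin m) TA) (hqc : q ∈ adelicMpCont F (Fin m) TA) (hq : MpPsi.proj _ q = g)
    (hj : ∀ p : ↥(siegelDelta L e dV hdV dW hdW),
      g⁻¹ * ((adelicMpCont.proj F (Fin m) TA).comp (s.comp (siegelDelta L e dV hdV dW hdW).subtype)) p * g ∈ siegelParabolicPi TA)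
    {u : HA L e dV hdV dW hdW} (hu : u ∈ unipDelta L e dV hdV dW hdW) (Φ : piSchwartzBruhat F (Fin m)) :
    adelicMpCont.omega F (Fin m) TA (s u) Φ =
      MpPsi.toOp (adelicSchrodinger F (Fin m) TA) q
        (MpPsi.toOp (adelicSchrodinger F (Fin m) TA)
          (adelicSiegelLift F TA hT ⟨g⁻¹ * adelicMpCont.proj F (Fin m) TA (s u) * g, hj ⟨u, unipDelta_le_siegelDelta L e dV hdV dW hdW hu⟩⟩)
          ((MpPsi.toOp (adelicSchrodinger F (Fin m) TA) q)⁻¹ Φ)) :=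
  (congrArg (fun p => adelicMpCont.omega F (Fin m) TA p Φ)
      (eq_adelicSiegelLiftConj_of_mem_unipDelta L e dV hdV dW hdW hdV0 hdW0 hT s g q hqc hq hj hu)).trans
    (omega_adelicSiegelLiftConj_apply hT g q hqc hq _ hj _ Φ)

end SiegelLift

end Datum

end Summit.HodgeConjecture.HodgeConjecture.Cruxes.HLiu418.K2LiuMetaplecticUnipotentRigidity

end
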